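import Summits.MatrixMultiplication.MatrixMultiplication.Theorems.GradedDesignFamily.Negative.SubfieldCellNineRowTwo
import Summits.MatrixMultiplication.MatrixMultiplication.Theorems.GradedDesignFamily.Negative.SubfieldCellNineEmbedding

/-!
# Subfield cell `GL₂(𝔽₉) ⊃ SL₂(𝔽₃)` at level one — V: `|Y| ≥ 2 ⇒ |Z| ≤ 17` for EVERY `(k, K, φ)`

**Honest framing.** VALUE = a kernel-checked verdict about ONE finite cell (`|k| = 3`, `|K| = 9`) of
ONE skeleton line (`quadratic_extension_level_one_cell`, stub S3 `stub_subfieldCell`, crux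
`GradedDesignFamily`, route `LevelGradedCohnUmans`).  It is **not** summit progress (no bound on
`ω` is touched) and does **not** refute `stub_subfieldCell` (`∃ c > 0, ∀ N, ∃ (k, K, φ) …` is
insensitive to any single cell).

## The theorem

`subfieldCell_nine_rowTwo`: for all fields `k, K` with `|k| = 3`, `|K| = |k|²`, every injective
`φ : SL₂(k) →* GL₂(K)` and all finite `Y, Z ⊆ GL₂(K)` satisfying the separation clause of S3
verbatim: `2 ≤ |Y| → |Z| ≤ 17`.  (Sharp: `subfieldCell_nine_witnessD`, `(|Y|,|Z|) = (2,17)`.)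
On the row `|Y| = 2` this improves the cusp-form wall `|Y| + |Z| ≤ 21` (`subfieldCell_nine_wall`)
by two.

## Proof

`isSep_transport`: identify `k ≅ 𝔽₃` (`ZMod.ringEquivOfPrime`) and `K ≅ 𝔽₉ = QuadraticAlgebra (ZMod 3) (-1) 0`
(`FiniteField.ringEquivOfCardEq`); the transported embedding is conjugate to `mapGL` by some `G`
(`embedding_conj`, file IV); then `Y ↦ G⁻¹Ψ(Y)`, `Z ↦ G⁻¹Ψ(Z)G` and
`cf ↦ cf ∘ (ψ⁻¹ ∘ (G·))` carry separated designs to separated designs of the standard model with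
the same cardinalities, where `isSep_card_le` (file III) applies.
-/

set_option linter.dupNamespace false

namespace Summit.MatrixMultiplication.MatrixMultiplication.Theorems.GradedDesignFamily.Negative.SubfieldNine

open Matrix

/-- `|𝔽₉| = 9`. -/
theorem card_K : Fintype.card K = 9 := rfl

/-- **Transport to the standard model.** Any level-one separated triple `(φ(SL₂ k), Y, Z)` in
`GL₂(K')`, `|k| = 3`, `|K'| = 9`, yields one in the standard model with the same `|Y|, |Z|`. -/
theorem isSep_transport {k K' : Type} [Field k] [Fintype k] [DecidableEq k] [Field K']
    [Fintype K'] [DecidableEq K'] (hk : Fintype.card k = 3)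
    (φ : Matrix.SpecialLinearGroup (Fin 2) k →* Matrix.GeneralLinearGroup (Fin 2) K')
    (hφ : Function.Injective φ) (hK : Fintype.card K' = Fintype.card k ^ 2)
    (Y Z : Finset (Matrix.GeneralLinearGroup (Fin 2) K'))
    (hsep : ∀ z₀ ∈ Z, ∃ cf : (Fin 2 → K') → (Fin 2 → K') → ℂ,
      ∀ a : Matrix.SpecialLinearGroup (Fin 2) k, ∀ y ∈ Y, ∀ y' ∈ Y, ∀ z ∈ Z,
        (∑ u : Fin 2 → K', cf u (((φ a * y * y'⁻¹ * z : Matrix.GeneralLinearGroup (Fin 2) K') :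
            Matrix (Fin 2) (Fin 2) K').mulVec u)) =
          if a = 1 ∧ y = y' ∧ z = z₀ then 1 else 0) :
    ∃ Y' Z' : Finset (GL (Fin 2) K), Y'.card = Y.card ∧ Z'.card = Z.card ∧ IsSep Y' Z' := by
  have h3 : Nat.Prime 3 := by norm_num
  -- `k ≅ 𝔽₃`
  let ι : ZMod 3 ≃+* k := ZMod.ringEquivOfPrime k h3 hk
  let F : SL3 →* Matrix.SpecialLinearGroup (Fin 2) k := Matrix.SpecialLinearGroup.map ι.toRingHom
  have hFcoe : ∀ a : SL3, ∀ i j,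
      (F a : Matrix (Fin 2) (Fin 2) k) i j = ι ((a : Matrix (Fin 2) (Fin 2) (ZMod 3)) i j) := by
    intro a i j; rfl
  have hFinj : Function.Injective F := by
    intro a b hab
    ext i j
    have h := congrArg (fun m : Matrix.SpecialLinearGroup (Fin 2) k =>
      (m : Matrix (Fin 2) (Fin 2) k) i j) hab
    simp only [hFcoe] at h
    exact ι.injective h
  -- `K' ≅ 𝔽₉`
  have hK9 : Fintype.card K' = Fintype.card K := by rw [hK, hk, card_K]; norm_num
  let ψ : K' ≃+* K := FiniteField.ringEquivOfCardEq hK9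
  let Ψ : GL (Fin 2) K' →* GL (Fin 2) K := Matrix.GeneralLinearGroup.map ψ.toRingHom
  have hΨcoe : ∀ g : GL (Fin 2) K', ∀ i j,
      ((Ψ g : GL (Fin 2) K) : Mat) i j = ψ ((g : Matrix (Fin 2) (Fin 2) K') i j) := by
    intro g i j
    exact Matrix.GeneralLinearGroup.map_apply _ i j g
  have hΨinj : Function.Injective Ψ := by
    intro a b hab
    apply Units.ext
    ext i j
    have h := congrArg (fun m : GL (Fin 2) K => (m : Mat) i j) hab
    simp only [hΨcoe] at h
    exact ψ.injective h
  -- the transported embedding is conjugate to `mapGL`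
  let φ' : SL3 →* GL (Fin 2) K := Ψ.comp (φ.comp F)
  have hφ' : Function.Injective φ' := hΨinj.comp (hφ.comp hFinj)
  obtain ⟨G, hG⟩ := embedding_conj φ' hφ'
  -- the transported sets
  let fY : GL (Fin 2) K' → GL (Fin 2) K := fun y => G⁻¹ * Ψ y
  let fZ : GL (Fin 2) K' → GL (Fin 2) K := fun z => G⁻¹ * Ψ z * G
  have hfY : Function.Injective fY := fun a b h => hΨinj (mul_left_cancel h)
  have hfZ : Function.Injective fZ := fun a b h => hΨinj (mul_left_cancel (mul_right_cancel h))
  refine ⟨Y.image fY, Z.image fZ, Finset.card_image_of_injective _ hfY,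
    Finset.card_image_of_injective _ hfZ, ?_⟩
  intro z₀' hz₀'
  obtain ⟨z₀, hz₀, rfl⟩ := Finset.mem_image.1 hz₀'
  obtain ⟨cf, hcf⟩ := hsep z₀ hz₀
  -- the change of frames `θ u = ψ⁻¹ (G u)`
  let θ : Vec → (Fin 2 → K') := fun u i => ψ.symm (((G : Mat) *ᵥ u) i)
  refine ⟨fun u v => cf (θ u) (θ v), ?_⟩
  intro a₀ y₁' hy₁' y₂' hy₂' z' hz'
  obtain ⟨y₁, hy₁, rfl⟩ := Finset.mem_image.1 hy₁'
  obtain ⟨y₂, hy₂, rfl⟩ := Finset.mem_image.1 hy₂'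
  obtain ⟨z, hz, rfl⟩ := Finset.mem_image.1 hz'
  set M : GL (Fin 2) K' := φ (F a₀) * y₁ * y₂⁻¹ * z with hM
  have hprod : Matrix.SpecialLinearGroup.mapGL K a₀ * fY y₁ * (fY y₂)⁻¹ * fZ z = G⁻¹ * Ψ M * G := by
    have h1 : Matrix.SpecialLinearGroup.mapGL K a₀ = G⁻¹ * φ' a₀ * G := by rw [hG a₀]; group
    have h2 : φ' a₀ = Ψ (φ (F a₀)) := rfl
    rw [h1, h2, hM, map_mul, map_mul, map_mul, map_inv]
    simp only [fY, fZ]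
    group
  rw [hprod]
  -- the summand, rewritten
  have hsummand : ∀ u : Vec,
      θ (((G⁻¹ * Ψ M * G : GL (Fin 2) K) : Mat) *ᵥ u) = (M : Matrix (Fin 2) (Fin 2) K') *ᵥ θ u := by
    intro u
    have e1 : (G : Mat) *ᵥ (((G⁻¹ * Ψ M * G : GL (Fin 2) K) : Mat) *ᵥ u) =
        ((Ψ M : GL (Fin 2) K) : Mat) *ᵥ ((G : Mat) *ᵥ u) := by
      rw [Units.val_mul, Units.val_mul, Matrix.mulVec_mulVec, ← _root_.mul_assoc, ← _root_.mul_assoc,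
        Units.mul_inv, _root_.one_mul, ← Matrix.mulVec_mulVec]
    funext i
    simp only [θ]
    rw [e1]
    generalize (G : Mat) *ᵥ u = w
    have hMw : ∀ i, (((Ψ M : GL (Fin 2) K) : Mat) *ᵥ w) i =
        ∑ j, ψ ((M : Matrix (Fin 2) (Fin 2) K') i j) * w j := by
      intro i
      simp only [Matrix.mulVec, dotProduct, hΨcoe]
    rw [hMw]
    simp only [Matrix.mulVec, dotProduct, map_sum, map_mul, RingEquiv.symm_apply_apply]
  simp only [hsummand]
  -- reindex the frame sum along the bijection `θ`
  let eG : Vec ≃ Vec :=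
    { toFun := fun u => (G : Mat) *ᵥ u
      invFun := fun u => ((G⁻¹ : GL (Fin 2) K) : Mat) *ᵥ u
      left_inv := fun u => by
        simp only [Matrix.mulVec_mulVec, Units.inv_mul, Matrix.one_mulVec]
      right_inv := fun u => by
        simp only [Matrix.mulVec_mulVec, Units.mul_inv, Matrix.one_mulVec] }
  let e : Vec ≃ (Fin 2 → K') := eG.trans (Equiv.piCongrRight fun _ : Fin 2 => ψ.symm.toEquiv)
  have he : ∀ u, e u = θ u := fun u => rfl
  simp only [← he]
  rw [Equiv.sum_comp e (fun v => cf v ((M : Matrix (Fin 2) (Fin 2) K') *ᵥ v)), hM,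
    hcf (F a₀) y₁ hy₁ y₂ hy₂ z hz]
  refine if_congr ?_ rfl rfl
  rw [map_eq_one_iff F hFinj, hfY.eq_iff, hfZ.eq_iff]

/-- **Row `|Y| = 2` of the `q = 3` cell, in full generality:** for all `(k, K, φ)` with `|k| = 3`,
`|K| = |k|²`, `φ : SL₂(k) ↪ GL₂(K)`, every level-one separated pair `(Y, Z)` (S3's clause verbatim)
with `|Y| ≥ 2` has `|Z| ≤ 17`.  Sharp (`subfieldCell_nine_witnessD`).  Finite-cell verdict, not
summit progress. -/
theorem subfieldCell_nine_rowTwo {k K' : Type} [Field k] [Fintype k] [DecidableEq k] [Field K']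
    [Fintype K'] [DecidableEq K'] (hk : Fintype.card k = 3)
    (φ : Matrix.SpecialLinearGroup (Fin 2) k →* Matrix.GeneralLinearGroup (Fin 2) K')
    (hφ : Function.Injective φ) (hK : Fintype.card K' = Fintype.card k ^ 2)
    (Y Z : Finset (Matrix.GeneralLinearGroup (Fin 2) K'))
    (hsep : ∀ z₀ ∈ Z, ∃ cf : (Fin 2 → K') → (Fin 2 → K') → ℂ,
      ∀ a : Matrix.SpecialLinearGroup (Fin 2) k, ∀ y ∈ Y, ∀ y' ∈ Y, ∀ z ∈ Z,
        (∑ u : Fin 2 → K', cf u (((φ a * y * y'⁻¹ * z : Matrix.GeneralLinearGroup (Fin 2) K') :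
            Matrix (Fin 2) (Fin 2) K').mulVec u)) =
          if a = 1 ∧ y = y' ∧ z = z₀ then 1 else 0)
    (hY : 2 ≤ Y.card) : Z.card ≤ 17 := by
  obtain ⟨Y', Z', hY', hZ', hsep'⟩ := isSep_transport hk φ hφ hK Y Z hsep
  have := isSep_card_le Y' Z' hsep' (by omega)
  omega

/-- The `(2,18)` instance of the `q = 3` subfield cell is FALSE for every `(k, K, φ)`. -/
theorem subfieldCell_nine_no_2x18 {k K' : Type} [Field k] [Fintype k] [DecidableEq k] [Field K']
    [Fintype K'] [DecidableEq K'] (hk : Fintype.card k = 3)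
    (φ : Matrix.SpecialLinearGroup (Fin 2) k →* Matrix.GeneralLinearGroup (Fin 2) K')
    (hφ : Function.Injective φ) (hK : Fintype.card K' = Fintype.card k ^ 2) :
    ¬ ∃ Y Z : Finset (Matrix.GeneralLinearGroup (Fin 2) K'), 2 ≤ Y.card ∧ 18 ≤ Z.card ∧
      ∀ z₀ ∈ Z, ∃ cf : (Fin 2 → K') → (Fin 2 → K') → ℂ,
        ∀ a : Matrix.SpecialLinearGroup (Fin 2) k, ∀ y ∈ Y, ∀ y' ∈ Y, ∀ z ∈ Z,
          (∑ u : Fin 2 → K', cf u (((φ a * y * y'⁻¹ * z : Matrix.GeneralLinearGroup (Fin 2) K') :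
              Matrix (Fin 2) (Fin 2) K').mulVec u)) =
            if a = 1 ∧ y = y' ∧ z = z₀ then 1 else 0 := by
  rintro ⟨Y, Z, hY, hZ, hsep⟩
  have := subfieldCell_nine_rowTwo hk φ hφ hK Y Z hsep hY
  omega

end Summit.MatrixMultiplication.MatrixMultiplication.Theorems.GradedDesignFamily.Negative.SubfieldNine
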